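import Mathlib

/-!
(v3 2026-08-29 g32: byte-identical to v2 below this header except the `set_option linter.dupNamespace false` line —
the 80/57 `dupNamespace` warnings came from the MANDATED duplicate `ResolutionOfSingularities.ResolutionOfSingularities`, as in
every tree file of this summit, e.g. ✓p569735 `…LiftCoreLocal.lean` :42; no declaration changed.)
# R22 — Pick / class ledger for NODAL customers (bookkeeping companion of `R22-NODAL-KEEP.md`)

[OURS · L1 W4.5b · IDEATOR 1 (res-L1-w45b-idea-1) g31 · 2026-08-29]  Arithmetic only — no algebraic geometry is
formalised here.  AI-written; nothing is attributed to [Hironaka2017]; EL♮(3) is NOT proved; counted 0.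

What is recorded (all by `decide` / `norm_num` / `omega`):
* `twiceArea`, `boundary`, `interior` (Pick's formula taken as the DEFINITION of the interior count) of a lattice polygon
  given by its vertex list; the rows quoted in the memo: the class polygon `P47 = [(0,0),(4,0),(0,8)]` of lead-1's Q47 curve
  (class `4C₀+8f` on `𝔽₂`): `(2A, B, I) = (32, 16, 9)`; its actual Newton polygon `[(0,0),(4,0),(0,7)]`: `(28, 12, 9)`;
  the plane family `[(0,0),(d,0),(0,d)]`, `d = 5,6,7`.
* the `𝔽₂` intersection form on classes `a•C₀ + b•f` (`C₀² = -2`, `C₀·f = 1`, `f² = 0`, `-K = 2C₀+4f`) and the check that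
  the class `(4,8)` has `(Γ², −K·Γ, p_a) = (32, 16, 9)` — the two dictionaries agree.
* the general identities behind §1/§5 of the memo: for a rational maximally nodal curve (`δ = I`) the strict transform after
  the `I` node blow-ups has `Γ̄² = 2A − 4I = B − 2 − 2I` (given Pick `2A = 2I + B − 2`), and the (HR-KEEP)-style test
  `Γ̄² ≥ −1 ↔ 2I + 1 ≤ B`; the Q47 verdicts `r21Currency = -4 < -1` (illegal in the R21 currency) while the (NK) clause's
  preconditions are positional (`nkLegal`), recorded as data.
-/

set_option linter.dupNamespace false -- mandated namespace `Summit.<Summit>.<Problem>` of this single-conjunct summit (v3, panel nit n-B)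

namespace Summit.ResolutionOfSingularities.ResolutionOfSingularities.Cruxes.EquisingularLiftNatThree.ToricTowers.R22

/-! ## Part A — lattice polygons: shoelace, lattice perimeter, Pick interior -/

/-- Twice the (signed) area of a closed lattice polygon given by its vertices in order (shoelace). -/
def twiceArea (vs : List (ℤ × ℤ)) : ℤ :=
  match vs with
  | [] => 0
  | v₀ :: _ =>
    let ws := vs ++ [v₀]
    ((ws.zip ws.tail).map fun pq => pq.1.1 * pq.2.2 - pq.2.1 * pq.1.2).sum

/-- Number of lattice points on the boundary: sum of gcds of the edge vectors. -/
def boundary (vs : List (ℤ × ℤ)) : ℤ :=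
  match vs with
  | [] => 0
  | v₀ :: _ =>
    let ws := vs ++ [v₀]
    ((ws.zip ws.tail).map fun pq => (Int.gcd (pq.2.1 - pq.1.1) (pq.2.2 - pq.1.2) : ℤ)).sum

/-- Interior lattice points, DEFINED through Pick's formula `2A = 2I + B − 2`. -/
def interior (vs : List (ℤ × ℤ)) : ℤ := (twiceArea vs - boundary vs + 2) / 2

/-- The ledger row `(2A, B, I)` of a polygon. -/
def pickRow (vs : List (ℤ × ℤ)) : ℤ × ℤ × ℤ := (twiceArea vs, boundary vs, interior vs)

/-- Class polygon of lead-1's Q47 curve: `𝒪(8)` on `ℙ(1,1,2)` / class `4C₀+8f` on `𝔽₂`. -/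
def P47 : List (ℤ × ℤ) := [(0, 0), (4, 0), (0, 8)]

/-- Actual Newton polygon of `D = T₄(X) − T₇(Z)` on the chart `y = 1` (no `Z⁸` term). -/
def NewtonD47 : List (ℤ × ℤ) := [(0, 0), (4, 0), (0, 7)]

/-- Plane family: Newton/class polygon of a degree-`d` plane curve. -/
def planeTriangle (d : ℤ) : List (ℤ × ℤ) := [(0, 0), (d, 0), (0, d)]

theorem pickRow_P47 : pickRow P47 = (32, 16, 9) := by decide
theorem pickRow_NewtonD47 : pickRow NewtonD47 = (28, 12, 9) := by decide
theorem pickRow_plane5 : pickRow (planeTriangle 5) = (25, 15, 6) := by decide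
theorem pickRow_plane6 : pickRow (planeTriangle 6) = (36, 18, 10) := by decide
theorem pickRow_plane7 : pickRow (planeTriangle 7) = (49, 21, 15) := by decide

/-- The two polygons of Q47 have the same interior count (the extra vertex `(0,8)` adds boundary only). -/
theorem interior_P47_eq_NewtonD47 : interior P47 = interior NewtonD47 := by decide

/-- `−K·Γ` read from the actual Newton polygon: the hypotenuse branch through the fixed point has lattice
length `1` but cone length `ℓ(u_x + 4u_y) = 5`, so `−K·Γ = B(Δ(D)) − 1 + 5 = 16 = B(P47)`. -/
theorem antican_from_NewtonD47 : boundary NewtonD47 - 1 + (1 + 4) = boundary P47 := by decide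

/-! ## Part B — the `𝔽₂` intersection form on classes `a•C₀ + b•f` -/

/-- A divisor class `a•C₀ + b•f` on the Hirzebruch surface `𝔽₂`. -/
structure F2Class where
  a : ℤ
  b : ℤ
deriving DecidableEq, Repr

/-- Intersection pairing: `C₀² = −2`, `C₀·f = 1`, `f² = 0`. -/
def F2Class.dot (D E : F2Class) : ℤ := -2 * D.a * E.a + D.a * E.b + D.b * E.a

/-- Anticanonical class `−K = 2C₀ + 4f`. -/
def antiK : F2Class := ⟨2, 4⟩

/-- Arithmetic genus by adjunction: `2p_a − 2 = D² + K·D`. -/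
def F2Class.pa (D : F2Class) : ℤ := (D.dot D - D.dot antiK + 2) / 2

/-- lead-1's class of the Q47 curve. -/
def gamma47 : F2Class := ⟨4, 8⟩
def C0 : F2Class := ⟨1, 0⟩
def fib : F2Class := ⟨0, 1⟩
/-- `C_∞ ∼ C₀ + 2f`. -/
def Cinf : F2Class := ⟨1, 2⟩

theorem gamma47_selfInt : gamma47.dot gamma47 = 32 := by decide
theorem gamma47_antiK : gamma47.dot antiK = 16 := by decide
theorem gamma47_pa : gamma47.pa = 9 := by decide
theorem gamma47_C0 : gamma47.dot C0 = 0 := by decide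
theorem gamma47_fib : gamma47.dot fib = 4 := by decide
theorem gamma47_Cinf : gamma47.dot Cinf = 8 := by decide
theorem Cinf_selfInt : Cinf.dot Cinf = 2 := by decide
theorem antiK_selfInt : antiK.dot antiK = 8 := by decide

/-- The class dictionary and the polygon dictionary agree on Q47. -/
theorem dictionaries_agree_Q47 :
    (gamma47.dot gamma47, gamma47.dot antiK, gamma47.pa) = pickRow P47 := by decide

/-! ## Part C — strict transform after the node rounds; the two currencies -/

/-- For a rational maximally nodal curve (`δ = I` ordinary nodes, each blown up once, multiplicity 2):
`Γ̄² = 2A − 4I`, and with Pick `2A = 2I + B − 2` this is `B − 2 − 2I`. -/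
theorem strict_selfInt_eq_of_pick (A2 B I : ℤ) (hPick : A2 = 2 * I + B - 2) :
    A2 - 4 * I = B - 2 - 2 * I := by omega

/-- `−K_Ē·Γ̄ = −K_E·Γ − 2I = B − 2I` (each node blow-up costs `2` against `−K`). -/
theorem strict_antiK_eq (B I : ℤ) : B - 2 * I = (B - 2 - 2 * I) + 2 := by omega

/-- The (HR-KEEP)-style certificate applied AFTER the node rounds: `Γ̄² ≥ −1 ↔ 2I + 1 ≤ B`.  It fails for every
polygon fat enough (`2I ≥ B`). -/
theorem hrkeep_test_iff (B I : ℤ) : -1 ≤ B - 2 - 2 * I ↔ 2 * I + 1 ≤ B := by omega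

/-- Q47: `Γ̄² = −4`, `−K_Ē·Γ̄ = −2`; the R21-currency certificate is `−4 < −1`. -/
theorem q47_strict : (32 : ℤ) - 4 * 9 = -4 ∧ (16 : ℤ) - 2 * 9 = -2 ∧ ¬ (-1 : ℤ) ≤ 16 - 2 - 2 * 9 := by decide

/-- Plane family: `Γ̄² = d² − 2(d−1)(d−2) = −d² + 6d − 4`; rows `d = 5, 6, 7 ↦ 1, −4, −11`; the test fails iff `d ≥ 6`. -/
theorem plane_rows :
    ((5 : ℤ) ^ 2 - 4 * 6, (6 : ℤ) ^ 2 - 4 * 10, (7 : ℤ) ^ 2 - 4 * 15) = (1, -4, -11) := by decide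
theorem plane_nodes : ((5 - 1) * (5 - 2) / 2, (6 - 1) * (6 - 2) / 2, (7 - 1) * (7 - 2) / 2) = ((6 : ℤ), (10 : ℤ), (15 : ℤ)) := by
  decide
/-- For `d ≥ 3`: `−d² + 6d − 4 ≥ −1 ↔ d ≤ 5` (so sextics are the first plane separating customers). -/
theorem plane_test_iff (d : ℤ) (hd : 3 ≤ d) : -1 ≤ -d ^ 2 + 6 * d - 4 ↔ d ≤ 5 := by
  constructor
  · intro h; nlinarith
  · intro h; nlinarith

/-! ## Part D — the (NK) clause as a record: positional preconditions, no numerical certificate -/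

/-- A nodal customer letter as the memo reads it: host data at LIFT time. -/
structure NodalLetter where
  /-- (T1) the host is a boundary divisor of the toric stage when the curve is lifted -/
  hostToricAtLift : Bool
  /-- (T2) integral, only ordinary nodes, immersive normalisation (boundary nodes kept on the boundary) -/
  ordinaryNodalIntegral : Bool
  /-- (T3) the node rounds are point rounds with no further incidence demand -/
  nodeRoundsArePoints : Bool
  /-- (T4) no non-toric round touches the host between the lift and the curve's round -/
  noNonToricTouchBefore : Bool
  /-- class data `(2A, B, I)` of the class polygon -/
  twiceA : ℤ
  bdry : ℤ
  intr : ℤ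
deriving DecidableEq, Repr

/-- (NK) legality: purely positional. -/
def NodalLetter.nkLegal (L : NodalLetter) : Bool :=
  L.hostToricAtLift && L.ordinaryNodalIntegral && L.nodeRoundsArePoints && L.noNonToricTouchBefore

/-- The R21 currency (self-intersection of the strict transform after the node rounds). -/
def NodalLetter.r21Currency (L : NodalLetter) : ℤ := L.twiceA - 4 * L.intr

/-- The R21-style verdict `cert ≥ −1`. -/
def NodalLetter.r21Legal (L : NodalLetter) : Bool := decide (-1 ≤ L.r21Currency)

/-- Q47 as described by lead-1 g18 (preconditions (T1)–(T4) are THEIR record to confirm; entered `true` here as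
the memo's reading). -/
def q47 : NodalLetter := ⟨true, true, true, true, 32, 16, 9⟩

/-- The separating verdict: illegal in the R21 currency, legal under (NK). -/
theorem q47_separates : q47.r21Currency = -4 ∧ q47.r21Legal = false ∧ q47.nkLegal = true := by decide

/-- Plane sextic analogue `P6` (10-nodal rational sextic in a fresh plane): same verdict. -/
def p6 : NodalLetter := ⟨true, true, true, true, 36, 18, 10⟩
theorem p6_separates : p6.r21Currency = -4 ∧ p6.r21Legal = false ∧ p6.nkLegal = true := by decide

/-- Plane quintic analogue `P5` (6 nodes): NOT separating — both currencies pass. -/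
def p5 : NodalLetter := ⟨true, true, true, true, 25, 15, 6⟩
theorem p5_not_separating : p5.r21Currency = 1 ∧ p5.r21Legal = true ∧ p5.nkLegal = true := by decide


/-! ## Part E — «nodes first» (§10 addendum): the normal class of `E_ℓ`, the numbers after the nine node rounds,
and the section-tower certificates over the smooth strict transform `Γ̄`

`N_{E_ℓ} = 𝒪_{ℙ(N_ℓ)}(−1)` has class `−C₀ − f` on `E_ℓ ≅ 𝔽₂` (degree `+1` on `C₀ = ℙ(𝒪(1))`, `−1` on a fibre); the rule
`N_{ℙ(L₂)} ≅ L₁ ⊗ L₂^∨` in `ℙ(L₁ ⊕ L₂)` gives a section's self-intersection as `deg L₁ − deg L₂`. -/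

/-- The normal class of `E_ℓ` restricted to `E_ℓ`: `−C₀ − f`. -/
def normEl : F2Class := ⟨-1, -1⟩

theorem normEl_C0 : normEl.dot C0 = 1 := by decide
theorem normEl_fib : normEl.dot fib = -1 := by decide
/-- `E_ℓ³ = (−C₀ − f)² = 0 = −deg N_ℓ` (`N_ℓ = 𝒪(1) ⊕ 𝒪(−1)`). -/
theorem normEl_selfInt : normEl.dot normEl = 0 ∧ (1 : ℤ) + (-1) = 0 := by decide
/-- `E_ℓ · Γ₀ = (−C₀ − f)·(4C₀ + 8f) = −4`. -/
theorem El_dot_gamma47 : normEl.dot gamma47 = -4 := by decide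
/-- The section rule checked on `E_ℓ = ℙ(𝒪(1) ⊕ 𝒪(−1))`: `C₀ = ℙ(𝒪(1))` has `C₀² = deg 𝒪(−1) − deg 𝒪(1) = −2`. -/
theorem sectionRule_C0 : (-1 : ℤ) - 1 = C0.dot C0 := by decide

/-- After the nine node point rounds (two branches through each node): `deg N_{Ē_ℓ}|Γ̄ = −4 − 2·9`, `Γ̄² = 32 − 4·9`. -/
theorem after_nodes : (-4 : ℤ) - 2 * 9 = -22 ∧ (32 : ℤ) - 4 * 9 = -4 := by decide

/-- Certificate of the `j`-th curve round over `Γ̄` in the order «σ⁹, Γ̄, Γ′, Γ″, …» (`j = 0` is `Γ̄` itself):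
`cert_j = Γ̄² + j·(2r − E_ℓ·Γ₀) = −4 + 22 j`; the host of floor `j ≥ 1` is `𝔽_{22j−4}`. -/
def certNodesFirst (j : ℕ) : ℤ := -4 + 22 * j

theorem certNodesFirst_rows :
    (certNodesFirst 0, certNodesFirst 1, certNodesFirst 2, certNodesFirst 3) = (-4, 18, 40, 62) := by decide
/-- `cert₁ = deg N_{Γ̄/Ē_ℓ} − deg L = −4 − (−22)`. -/
theorem cert_one_by_sectionRule : (-4 : ℤ) - (-22) = certNodesFirst 1 := by decide
/-- Only the `Γ̄` round fails the (HR-KEEP) test; every floor `j ≥ 1` passes it. -/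
theorem certNodesFirst_fails_iff (j : ℕ) : ¬ (-1 ≤ certNodesFirst j) ↔ j = 0 := by
  unfold certNodesFirst; constructor
  · intro h; by_contra hj; have : (1 : ℤ) ≤ j := by exact_mod_cast Nat.one_le_iff_ne_zero.mpr hj
    omega
  · rintro rfl; decide

/-- Multiplicity of `St H` at a node of `Γ₀` for transversal type `A_{2k−1}` (`f_P = (uv)²α + y^{2k}ε`): `min 4 (2k)`;
the tangent cone is reduced iff `2k = 4`. Rows `k = 1, 2, 3`. -/
theorem node_mult_rows : (min 4 (2 * 1), min 4 (2 * 2), min 4 (2 * 3)) = ((2 : ℕ), (4 : ℕ), (4 : ℕ)) ∧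
    (2 * 1 ≠ 4 ∧ 2 * 2 = 4 ∧ 2 * 3 ≠ 4) := by decide

/-- Word bookkeeping: `k = 1` spawned boundary line `ē_P² = 1 − 2 = −1` in `Bl_{b,b′} E_P` (legal), word length
`2 + 9 + 1 + 9 = 21`; `k = 2` clean, `2 + 9 + 1 + 1 = 13`; `k = 3` lines `λ̄_P² = μ̄_P² = 1 − 1 = 0`, `2 + 9 + 1 + 9 + 9 + 2 = 32`;
versus «Γ₀ first»: `3` (lead-1 B2) and `22` (idea-2 NU6 (b)). -/
theorem nodesFirst_words : (1 : ℤ) - 2 = -1 ∧ (2 + 9 + 1 + 9 = 21) ∧ (2 + 9 + 1 + 1 = 13) ∧ (1 : ℤ) - 1 = 0 ∧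
    (2 + 9 + 1 + 9 + 9 + 2 = 32) ∧ ((-1 : ℤ) ≤ -1) ∧ ((-1 : ℤ) ≤ 0) := by decide

end Summit.ResolutionOfSingularities.ResolutionOfSingularities.Cruxes.EquisingularLiftNatThree.ToricTowers.R22
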